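import Summits.ResolutionOfSingularities.ResolutionOfSingularities.Theorems.FrobeniusClosingPatchingRelPerfectMonomialPairStep
import HarnessLib

/-!
# Crux `PatchingRelPerfect` (stmt-ResolutionOfSingularities-16161), chain w52 — R4 support:
# PRINCIPALIZATION OF A PAIR OF MONOMIAL IDEALS, part 3 (the theorem)

[OURS · L1 W5.2 · R4 support «monomial cleanup»] For two exponent lists `A`, `B` on the same simple
normal crossings boundary of a locally Noetherian scheme `X` (so `X` is regular), the ideal
`monomialIdeal A ⊔ monomialIdeal B` — locally `(zᵃ, zᵇ)` in a regular system of parameters — is made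
LOCALLY PRINCIPAL by a finite sequence of blowings up of codimension-two strata `V(K) ∩ V(L)` of the
successive (again snc) boundaries, `K` running through the divisors with `a_K > b_K` and `L` through
those with `a_L < b_L` (**`exists_centreSeq_principalize`**; predicate form
`admitsStratumPrincipalization`; corollary `exists_centreSeq_isLocallyPrincipal_comap`: the total
transform of the sum is locally principal on a regular scheme).  Any dimension, any characteristic, no
base field, no excellence; fact-free — the «monomial cleanup by codim-2 strata» of the two-layer rung R4
(tri-1 04:21:57Z (1)) and the missing «general monomial ideals» module of CHAIN v1.5 §3.

TERMINATION (the number of bad pairs is NOT monotone in dimension `≥ 3`): the measure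
`(maxVal, numMax)` of part 1 drops lexicographically at each step of part 2 (`exists_step`, applied to
`(A, B)` or, by symmetry, to `(B, A)`); `principalize_aux` is the nested strong induction, exactly as in
Kollár's order reduction for marked monomial ideals (`MonomialOrderReduction.lean`).  Nothing here is a
statement of the manuscript under review.

## References

* J. Kollár, *Lectures on Resolution of Singularities* (2007), (3.111) Step 3, Def. 3.25. [Kollar2007]
* R. Goward, *A simple algorithm for principalization of monomial ideals*, Trans. AMS 357 (2005),
  §2. [Goward2005]
* U. Görtz, T. Wedhorn, *Algebraic Geometry I* (2nd ed. 2020), Prop. 13.91, 13.92. [GortzWedhorn2020]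
-/

-- `Summit.<Summit>.<Sub>.Theorems` with `Sub = Summit` (single-conjunct summit, D-0017)
set_option linter.dupNamespace false

noncomputable section

open CategoryTheory AlgebraicGeometry TopologicalSpace IsLocalRing
open Literature.AlgebraicGeometry.Resolution

namespace Summit.ResolutionOfSingularities.ResolutionOfSingularities.Theorems

namespace MonomialCleanup

universe u

/-! ## The induction -/

section Induction

/-- Prepending one blow-up step to a solution on the blow-up. [folklore] -/
theorem AdmitsStratumPrincipalization.cons {X : Scheme.{u}} {A B : List (X.IdealSheafData × ℕ)} (C : X.IdealSheafData)
    {A₁ B₁ : List ((blowup C).IdealSheafData × ℕ)} (hC : Scheme.IsRegular C.subscheme)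
    (hCsupp : (C.support : Set X) ⊆ (monomialIdeal A ⊔ monomialIdeal B).support)
    (hA₁ : (monomialIdeal A).comap (blowup.π C) = monomialIdeal A₁)
    (hB₁ : (monomialIdeal B).comap (blowup.π C) = monomialIdeal B₁) (h : AdmitsStratumPrincipalization A₁ B₁) :
    AdmitsStratumPrincipalization A B := by
  obtain ⟨s, A', B', hreg, hover, hbd, hsnc, hA, hB, hlp⟩ := h
  refine ⟨CentreSeq.cons C s, A', B', (CentreSeq.allRegular_cons C s).mpr ⟨hC, hreg⟩, ?_, hbd, hsnc, ?_, ?_, hlp⟩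
  · refine (CentreSeq.centresOver_cons C s _).mpr ⟨hCsupp, CentreSeq.CentresOver.mono s ?_ hover⟩
    intro x' hx'
    have h1 : x' ∈ (((monomialIdeal A ⊔ monomialIdeal B).comap (blowup.π C)).support : Set (blowup C)) := by
      rw [Scheme.IdealSheafData.comap_sup, hA₁, hB₁]; exact hx'
    rw [Scheme.IdealSheafData.support_comap] at h1
    exact h1
  · have h : (monomialIdeal A).comap (s.comp ≫ blowup.π C) = monomialIdeal A' := by
      rw [Scheme.IdealSheafData.comap_comp, hA₁, hA]
    exact h
  · have h : (monomialIdeal B).comap (s.comp ≫ blowup.π C) = monomialIdeal B' := by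
      rw [Scheme.IdealSheafData.comap_comp, hB₁, hB]
    exact h

/-- **The induction** on the measure `(maxVal, numMax)`, lexicographically.
[cite: Kollar2007, (3.111) Step 3] -/
theorem principalize_aux : ∀ (M n : ℕ) (X : Scheme.{u}) [IsLocallyNoetherian X]
    (A B : List (X.IdealSheafData × ℕ)), HasSNC (boundaryOf A) → boundaryOf A = boundaryOf B →
    maxVal A B = M → numMax A B = n → AdmitsStratumPrincipalization A B := by
  intro M
  induction M using Nat.strong_induction_on with
  | _ M ihM =>
  intro n
  induction n using Nat.strong_induction_on with
  | _ n ihn =>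
  intro X _ A B hE hAB hM hn
  classical
  by_cases hemp : badPairs A B = ∅
  · -- no bad pair: already locally principal
    exact admitsStratumPrincipalization_of_badPairs_eq_empty hE hAB hemp
  · have hnonempty : (badPairs A B).Nonempty := Finset.nonempty_iff_ne_empty.mpr hemp
    obtain ⟨p₀, hp₀, hp₀v⟩ := exists_value_eq_maxVal hnonempty
    -- a step exists, on the `A`-side or (by symmetry) on the `B`-side
    obtain ⟨C, A', B', hC, hCsupp, hbd, hsnc, hA', hB', hmeas⟩ :
        ∃ (C : X.IdealSheafData) (A' B' : List ((blowup C).IdealSheafData × ℕ)),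
          Scheme.IsRegular C.subscheme ∧
          (C.support : Set X) ⊆ (monomialIdeal A ⊔ monomialIdeal B).support ∧
          boundaryOf A' = boundaryOf B' ∧ HasSNC (boundaryOf A') ∧
          (monomialIdeal A).comap (blowup.π C) = monomialIdeal A' ∧
          (monomialIdeal B).comap (blowup.π C) = monomialIdeal B' ∧
          (maxVal A' B' < maxVal A B ∨ (maxVal A' B' = maxVal A B ∧ numMax A' B' < numMax A B)) := by
      rcases max_choice (expOf A p₀.1 - expOf B p₀.1) (expOf B p₀.2 - expOf A p₀.2) with h | h
      · exact exists_step hE hAB ⟨p₀, hp₀, by rw [← hp₀v, value, h]⟩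
      · -- the `B`-side: apply the step to `(B, A)` and swap back
        have hp₀' : p₀.swap ∈ badPairs B A := by
          rw [badPairs_swap]; exact Finset.mem_map_of_mem _ hp₀
        obtain ⟨C, B', A', hC, hCsupp, hbd, hsnc, hB', hA', hmeas⟩ :=
          exists_step (A := B) (B := A) (hAB ▸ hE) hAB.symm
            ⟨p₀.swap, hp₀', by rw [maxVal_swap, ← hp₀v, value, h, Prod.fst_swap]⟩
        refine ⟨C, A', B', hC, by rwa [sup_comm] at hCsupp, hbd.symm, hbd ▸ hsnc, hA', hB', ?_⟩
        rwa [maxVal_swap A' B', maxVal_swap A B, numMax_swap A' B', numMax_swap A B] at hmeas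
    haveI : IsLocallyNoetherian (blowup C) := CentreSeq.isLocallyNoetherian_blowup C
    refine AdmitsStratumPrincipalization.cons C hC hCsupp hA' hB' ?_
    rcases hmeas with hlt | ⟨heq, hlt⟩
    · exact ihM _ (hM ▸ hlt) _ (blowup C) A' B' hsnc hbd rfl rfl
    · exact ihn _ (hn ▸ hlt) (blowup C) A' B' hsnc hbd (heq.trans hM) rfl

end Induction

/-! ## The theorem -/

/-- **Principalization of a pair of monomial ideals by blowing up codimension-two strata**
(predicate form). [cite: Kollar2007, (3.111) Step 3] [cite: Goward2005, §2] -/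
theorem admitsStratumPrincipalization {X : Scheme.{u}} [IsLocallyNoetherian X]
    (A B : List (X.IdealSheafData × ℕ)) (hAB : boundaryOf A = boundaryOf B) (hE : HasSNC (boundaryOf A)) :
    AdmitsStratumPrincipalization A B :=
  principalize_aux _ _ X A B hE hAB rfl rfl

/-- **Principalization of a pair of monomial ideals by blowing up codimension-two strata.** On a
locally Noetherian scheme `X`, let `A`, `B` be exponent lists on the same boundary with simple normal
crossings (so `X` is regular).  Then there is a finite sequence of blowings up with REGULAR centres —
strata `V(K) ∩ V(L)` of two boundary divisors, lying over the cosupport of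
`monomialIdeal A ⊔ monomialIdeal B` — after which the total transforms of `monomialIdeal A` and
`monomialIdeal B` are the monomial ideals of exponent lists `A'`, `B'` on a common simple normal
crossings boundary and `monomialIdeal A' ⊔ monomialIdeal B'` (the total transform of
`monomialIdeal A ⊔ monomialIdeal B`) is LOCALLY PRINCIPAL.  Any dimension; no base field,
characteristic or excellence hypothesis. [cite: Kollar2007, (3.111) Step 3] [cite: Goward2005, §2] -/
theorem exists_centreSeq_principalize {X : Scheme.{u}} [IsLocallyNoetherian X]
    (A B : List (X.IdealSheafData × ℕ)) (hAB : boundaryOf A = boundaryOf B) (hE : HasSNC (boundaryOf A)) :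
    ∃ (s : CentreSeq X) (A' B' : List (s.top.IdealSheafData × ℕ)),
      s.AllRegular ∧ s.CentresOver ((monomialIdeal A ⊔ monomialIdeal B).support : Set X) ∧
      boundaryOf A' = boundaryOf B' ∧ HasSNC (boundaryOf A') ∧
      (monomialIdeal A).comap s.comp = monomialIdeal A' ∧
      (monomialIdeal B).comap s.comp = monomialIdeal B' ∧
      IsLocallyPrincipal (monomialIdeal A' ⊔ monomialIdeal B') :=
  admitsStratumPrincipalization A B hAB hE

/-- **Corollary: the total transform of `monomialIdeal A ⊔ monomialIdeal B` along the sequence is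
locally principal, on a regular scheme** (the last scheme carries an snc boundary).
[cite: Kollar2007, (3.111) Step 3] -/
theorem exists_centreSeq_isLocallyPrincipal_comap {X : Scheme.{u}} [IsLocallyNoetherian X]
    (A B : List (X.IdealSheafData × ℕ)) (hAB : boundaryOf A = boundaryOf B) (hE : HasSNC (boundaryOf A)) :
    ∃ s : CentreSeq X, s.AllRegular ∧
      s.CentresOver ((monomialIdeal A ⊔ monomialIdeal B).support : Set X) ∧
      Scheme.IsRegular s.top ∧
      IsLocallyPrincipal ((monomialIdeal A ⊔ monomialIdeal B).comap s.comp) := by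
  obtain ⟨s, A', B', hreg, hover, -, hsnc, hA, hB, hlp⟩ := exists_centreSeq_principalize A B hAB hE
  refine ⟨s, hreg, hover, fun x => (hsnc x).1, ?_⟩
  rw [Scheme.IdealSheafData.comap_sup, hA, hB]
  exact hlp

end MonomialCleanup

end Summit.ResolutionOfSingularities.ResolutionOfSingularities.Theorems

end
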